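import Summits.CriticalPhenomena.Ising3DConformalLimit.Theorems.PerfectScreeningGaussianLimitNotScreenedMarkovRegression
import Summits.CriticalPhenomena.Ising3DConformalLimit.Theorems.PerfectScreeningGaussianLimitNotScreenedFormRiemannLimit
import Summits.CriticalPhenomena.Ising3DConformalLimit.Theorems.PerfectScreeningGaussianLimitNotScreenedContQSharp
import HarnessLib

/-!
# Crux `GaussianLimitNotScreened` (stmt-CriticalPhenomena-13886), line `single-layer-linear-regression`:
# the `Δ = 1/2` slice of single-layer linear regression (registered stub `stub_regressionLinearisesAtHalf`)

THEOREM-ONLY file. At `Δ = 1/2` the statement "for every `ε > 0` some macroscopic linear statistic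
`Σ_u n⁻²φ(u/n)σ_{(0,u)}` of the layer spins predicts the deep spin `σ_{(n,0,0)}` up to a mean-square
residual `≤ ε·G(2n e₀)`, for all large depths `n` and then all large boxes `L`" is a THEOREM for every
non-degenerate Möbius-covariant pointwise limit (no Gaussianity is needed). It is assembled from three
LANDED ingredients of the line:

* sharpness of the Riesz balayage bound (`stub_contQSharp`, at `Δ = 1/2`, `η = ε/4`): a continuous
  profile `φ` supported in the ball of radius `R` (a truncated Poisson kernel) with `Q_{1/2}(φ) > 1/2 − ε/4`,
  so that `1 − 4^{1/2}·Q_{1/2}(φ) < ε/2`;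
* the two-point Riemann limit of the regression form (`stub_formRiemannLimit`, at `Δ = 1/2`):
  `form(n)/G(2n e₀) → 1 − 4^{1/2}·Q_{1/2}(φ)`, hence `form(n) < ε·G(2n e₀)` for all large `n`;
* the Markov regression limit (`stub_markovRegression`): the finite-volume mean-square residual of
  `E_L[σ_{(n,0,0)} | layer]` against `Σ_u n⁻²φ(u/n)σ_{(0,u)}` tends to `form(n)` as `L → ∞`.

References: J. Glimm, A. Jaffe, *Quantum Physics* (2nd ed., 1987), §6.1 [GlimmJaffe1987];
N. S. Landkof, *Foundations of Modern Potential Theory* (1972), Ch. IV §5 [Landkof1972].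
-/

noncomputable section

namespace Summit.CriticalPhenomena.Ising3DConformalLimit.Cruxes.GaussianLimitNotScreened.SingleLayerLinearRegression

open MeasureTheory Filter Topology
open Literature.Probability.LatticeModels

/-- At `Δ = 1/2` the efficiency defect `1 − 4^{1/2}·Q_{1/2}(φ)` of a macroscopic linear statistic can be
made `< ε`: take the profile of `stub_contQSharp` with `η = ε/4` (`4^{1/2} = 2`).
[cite: Landkof1972, Chapter IV §5] -/
theorem atHalf_exists_profile (ε : ℝ) (hε : 0 < ε) :
    ∃ (φ : E2 → ℝ) (R : ℕ), Continuous φ ∧ (∀ v : E2, (R : ℝ) ≤ ‖v‖ → φ v = 0) ∧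
      1 - (4:ℝ) ^ (1 / 2 : ℝ) * contQ (1 / 2) φ < ε := by
  obtain ⟨φ, R, hφc, hφR, hQ⟩ :=
    stub_contQSharp (1 / 2) le_rfl (by norm_num) (ε / 4) (by positivity)
  have h4 : (4:ℝ) ^ (1 / 2 : ℝ) = 2 := by
    rw [show (4:ℝ) = 2 ^ (2:ℝ) by norm_num, ← Real.rpow_mul (by norm_num)]
    norm_num
  refine ⟨φ, R, hφc, hφR, ?_⟩
  rw [h4]
  linarith

/-- **Registered stub `stub_regressionLinearisesAtHalf`** (the `Δ = 1/2` slice of single-layer linear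
regression, a THEOREM for every non-degenerate Möbius limit): for every `ε > 0` there is a continuum
profile `φ ∈ C_c(ℝ²)` such that for all large depths `n` and then all large boxes `L`,
`E_L[(E_L[σ_{(n,0,0)}|layer] − Σ_u n⁻²φ(u/n)σ_{(0,u)})²] ≤ ε·G(2n e₀)`. Proof: `atHalf_exists_profile`
gives `φ`, `R` with `1 − 4^{1/2}Q_{1/2}(φ) < ε`; the two-point Riemann limit `stub_formRiemannLimit` at
`Δ = 1/2` makes `form(n) < ε·G(2n e₀)` for large `n` (`G(2n e₀) > 0`, `criticalTwoPoint_axis_pos`), and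
the Markov regression limit `stub_markovRegression` makes the finite-volume residual `< ε·G(2n e₀)` for
large `L`. [cite: GlimmJaffe1987, §6.1 Remark 'Transfer matrix of statistical physics', pp. 89–90] -/
theorem stub_regressionLinearisesAtHalf : ∀ (ρ : ℝ → ℝ) (S : CorrFamily 3), (∀ δ ∈ Set.Ioc (0:ℝ) 1, 0 < ρ δ) → HasPointwiseScalingLimit (criticalCorr 3) ρ S → IsNondegenerateTwoPoint S → IsMoebiusCovariant (1/2) S → ∀ ε : ℝ, 0 < ε → ∃ (φ : E2 → ℝ) (R : ℕ), Continuous φ ∧ (∀ v : E2, (R : ℝ) ≤ ‖v‖ → φ v = 0) ∧ ∀ᶠ n : ℕ in atTop, ∀ᶠ L : ℕ in atTop, msResidual n (layerBox R n) (profileCoeff φ n) L ≤ ε * criticalTwoPoint 3 (Pi.single 0 ((2 * n : ℕ) : ℤ)) := by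
  intro ρ S hρ hlim hnd hMo ε hε
  -- Step 1: a profile nearly saturating the balayage bound at `Δ = 1/2`
  obtain ⟨φ, R, hφc, hφR, hκ⟩ := atHalf_exists_profile ε hε
  -- Step 2: Riemann limit of the regression form, then the Markov regression limit in the box
  have hB := stub_formRiemannLimit ρ (1 / 2) S hρ hlim hnd hMo φ R hφc hφR
  refine ⟨φ, R, hφc, hφR, ?_⟩
  have hG2pos : ∀ n : ℕ, 0 < criticalTwoPoint 3 (Pi.single 0 ((2 * n : ℕ) : ℤ)) := fun n =>
    criticalTwoPoint_axis_pos (2 * n)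
  filter_upwards [hB.eventually_lt_const hκ] with n hn
  rw [div_lt_iff₀ (hG2pos n)] at hn
  filter_upwards [(stub_markovRegression n (layerBox R n) (profileCoeff φ n)).eventually_lt_const hn]
    with L hL
  exact hL.le

end Summit.CriticalPhenomena.Ising3DConformalLimit.Cruxes.GaussianLimitNotScreened.SingleLayerLinearRegression

end
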